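import Literature.MathematicalPhysics.QuantumFieldTheory.OSSlotFactorisation
import Literature.MathematicalPhysics.QuantumFieldTheory.OSAveragedSuperposition
import Literature.MathematicalPhysics.QuantumFieldTheory.OSAveragedClusters
import Literature.MathematicalPhysics.QuantumFieldTheory.OSRegularisedWeight
import Literature.MathematicalPhysics.QuantumFieldTheory.OSLogWeightLink
import Literature.MathematicalPhysics.QuantumFieldTheory.OSVectorNormGrowth
import HarnessLib

/-!
# The regularised left cluster of a slot and the damping bound (OS II, Ch. VI.1)

Topic `Literature/MathematicalPhysics/QuantumFieldTheory`. Osterwalder–Schrader II (Comm. Math. Phys. 42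
(1975)), Ch. VI.1, pp. 297–298: in the factorised form of the `i`-th slot of the skeleton
functional (`OSSlotFactorisation.slotInt_eq_inner_superposed`) the left vector is the superposition
`V_L = ∫ conj(W_L(u_L)) v(P(w' + (u_L, 0))) du_L` of the OS vectors of the left generators. This file
bounds its damped norm by the OS vector of ONE explicit test function:

  `‖e^{-LH} V_L‖ ≤ ‖v(K)‖,  K = Θ𝒜*`   (`norm_shiftH_leftSuperposed_le`),

where `𝒜 = leftRegCluster` is the **regularised left cluster** — the average of the skeleton
clusters `Ψ_L(· - a)` of the left one-point-tensor profiles over their point times `a ∈ ℝ^{m+1}`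
with the Schwartz weight `hW = regWeight (gap profiles) (anchor profile)` (`OSRegularisedWeight`),
realised as `avgCluster` (`OSAveragedClusters`) so that its Schwartz seminorms are controlled
uniformly in the sharpness of the time profiles `κ_j`.

Steps:
* positions of the left points as anchored configurations: `shTimes_baseVec_left`,
  `shTimes_baseVec_left_eq_gapAnchor` (`= gapAnchor (-w'/2, w' + u_L)`);
* the left generator as an OS adjoint of a skeleton cluster and its forward translates:
  `leftGen_eq_osAdjoint`, `translate_leftGen` (`P(· - s e₀) = Θ(Ψ_L-cluster at leftPos - s)*`),
  `exists_seminorm_leftGen_le`;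
* the regularised cluster: `leftRegCluster_apply` (integral over the point times),
  `tsupport_leftRegCluster` (all times `≤ -(w'/2 - r)`), `isPositiveTimeMulti_leftRegTest`;
* the superposition identity `leftRegTest_apply_eq_integral`
  (`K(y) = ∫ ρ(s) conj W_L(u_L) P(w' + (u_L,0))(y - |s|e₀) d(s,u_L)`, by the substitution
  `a = gapAnchor (-w'/2 - s, w' + u_L)`: `integral_gapAnchor`, `measurePreserving_anchorGapSubst`);
* the bound, from `norm_shiftH_integral_smul_le` (`OSAveragedSuperposition`).

## References

* K. Osterwalder, R. Schrader, *Axioms for Euclidean Green's functions II*, Comm. Math. Phys.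
  42 (1975) 281–305, Ch. VI.1. [OsterwalderSchraderCMP1975]
-/

noncomputable section


open MeasureTheory Set Filter
open _root_.Topology
open scoped InnerProductSpace NNReal ComplexConjugate SchwartzMap

namespace Literature.MathematicalPhysics.QuantumFieldTheory

open Literature.Analysis.Matrix
open Literature.MathematicalPhysics.QuantumLattice (SchwingerFamily IsPositiveTimeMulti)
open Literature.MathematicalPhysics.QuantumLattice.SchwingerFamily
open Literature.MathematicalPhysics.QuantumLattice.SchwingerFamily.OSSpace

/-! ### Reindexing filtered `Fin` sums -/

/-- A sum over `{a : Fin K | J ≤ a < m}` is a sum over `{a : Fin m | J ≤ a}` (`m ≤ K`). [folklore] -/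
theorem sum_filter_fin_Ico_eq {K m : ℕ} (hm : m ≤ K) (J : ℕ) (f : ℕ → ℝ) :
    ∑ a ∈ Finset.univ.filter (fun a : Fin K => J ≤ a.val ∧ a.val < m), f a.val =
      ∑ a ∈ Finset.univ.filter (fun a : Fin m => J ≤ a.val), f a.val := by
  have h1 : ∑ a ∈ Finset.univ.filter (fun a : Fin K => J ≤ a.val ∧ a.val < m), f a.val =
      ∑ a : Fin K, (if J ≤ a.val ∧ a.val < m then f a.val else 0) := by
    rw [Finset.sum_filter]
  have h2 : ∑ a ∈ Finset.univ.filter (fun a : Fin m => J ≤ a.val), f a.val =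
      ∑ a : Fin m, (if J ≤ a.val ∧ a.val < m then f a.val else 0) := by
    rw [Finset.sum_filter]
    refine Finset.sum_congr rfl fun a _ => ?_
    simp [a.isLt]
  rw [h1, h2, Fin.sum_univ_eq_sum_range (fun x => if J ≤ x ∧ x < m then f x else 0) K,
    Fin.sum_univ_eq_sum_range (fun x => if J ≤ x ∧ x < m then f x else 0) m]
  symm
  refine Finset.sum_subset (Finset.range_subset_range.2 hm) fun x _ hx => ?_
  rw [Finset.mem_range, not_lt] at hx
  rw [if_neg (fun h => absurd h.2 (not_lt.2 hx))]

/-! ### Positions of the left points -/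

section Positions

variable {m n : ℕ} (i : Fin (m + n + 1)) (w' : ℝ)

/-- **Positions of the left points**: for gaps `w' + (u_L ⧺ 0)` with `w' + u_L ≥ 0`, the recentred
time of the left point `J ≤ i` is `-w'/2 - ∑_{J ≤ a < m} (w' + u_{L,a})`. [folklore] -/
theorem shTimes_baseVec_left (hi : i.val = m) (uL : Fin m → ℝ) (huL : ∀ a, 0 ≤ w' + uL a)
    (J : Fin (m + n + 2)) (hJ : J.val ≤ m) :
    shTimes i w' (baseVec i w' (fun j => w' + Fin.append uL (0 : Fin n → ℝ) j)) J =
      -w' / 2 - ∑ a ∈ Finset.univ.filter (fun a : Fin m => J.val ≤ a.val), (w' + uL a) := by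
  unfold shTimes
  have hle : J.val ≤ (i.castSucc).val := by simp [hi, hJ]
  have hsum := gapTimes_sub_eq_sum (baseVec i w' (fun j => w' + Fin.append uL (0 : Fin n → ℝ) j)) hle
  have hval : ∀ a ∈ Finset.univ.filter (fun a : Fin (m + n + 1) => J.val ≤ a.val ∧ a.val < (i.castSucc).val),
      baseVec i w' (fun j => w' + Fin.append uL (0 : Fin n → ℝ) j) a = (fun x : ℕ => if h : x < m then w' + uL ⟨x, h⟩ else 0) a.val := by
    intro a ha
    rw [Finset.mem_filter] at ha
    have ham : a.val < m := by simpa [hi] using ha.2.2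
    have hai : a < i := Fin.lt_def.2 (by omega)
    rw [baseVec_apply_of_lt (w' := w') _ hai]
    simp only [dif_pos ham]
    have hcast : (a.castPred (Fin.ne_last_of_lt hai) : Fin (m + n)) = Fin.castAdd n ⟨a.val, ham⟩ := Fin.ext (by simp)
    rw [hcast, Fin.append_left, abs_of_nonneg (huL _)]
  rw [Finset.sum_congr rfl hval] at hsum
  have hK : (i.castSucc).val = m := by simp [hi]
  have hre := sum_filter_fin_Ico_eq (K := m + n + 1) (m := m) (by omega) J.val (fun x : ℕ => if h : x < m then w' + uL ⟨x, h⟩ else 0)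
  have hfilt : Finset.univ.filter (fun a : Fin (m + n + 1) => J.val ≤ a.val ∧ a.val < (i.castSucc).val) =
      Finset.univ.filter (fun a : Fin (m + n + 1) => J.val ≤ a.val ∧ a.val < m) := by rw [hK]
  rw [hfilt, hre] at hsum
  have hval2 : ∑ a ∈ Finset.univ.filter (fun a : Fin m => J.val ≤ a.val),
      (fun x : ℕ => if h : x < m then w' + uL ⟨x, h⟩ else 0) a.val =
      ∑ a ∈ Finset.univ.filter (fun a : Fin m => J.val ≤ a.val), (w' + uL a) :=
    Finset.sum_congr rfl fun a _ => by simp [a.isLt]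
  rw [hval2] at hsum
  linarith

/-- The same positions through `gapAnchor`: the left points sit at
`gapAnchor (-w'/2, w' + u_L)`. [folklore] -/
theorem shTimes_baseVec_left_eq_gapAnchor (hi : i.val = m) (uL : Fin m → ℝ) (huL : ∀ a, 0 ≤ w' + uL a)
    (J : Fin (m + 1)) :
    shTimes i w' (baseVec i w' (fun j => w' + Fin.append uL (0 : Fin n → ℝ) j)) ⟨J.val, by omega⟩ =
      gapAnchor m (-w' / 2, fun a => w' + uL a) J := by
  rw [shTimes_baseVec_left i w' hi uL huL _ (by simpa using Nat.lt_succ_iff.1 J.isLt)]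
  rcases Fin.eq_castSucc_or_eq_last J with ⟨J', rfl⟩ | rfl
  · rw [gapAnchor_castSucc, suffixSum_apply]
    rfl
  · rw [gapAnchor_last]
    simp only [Fin.val_last]
    have hempty : Finset.univ.filter (fun a : Fin m => m ≤ a.val) = ∅ := by
      ext a; simp [not_le.2 a.isLt]
    simp [hempty]

end Positions


/-! ### The left generator as the OS adjoint of a skeleton cluster, and its translates -/

section LeftFamily

variable {d : ℕ} [NeZero d] {m n : ℕ} (φ : Fin (m + n + 2) → 𝓢(EuclideanSpace ℝ (Fin d), ℂ))
  (i : Fin (m + n + 1)) (w' : ℝ)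

/-- The **left profile tensor** `Ψ_L = ⊗_{J ≤ i} φ_J`. [folklore] -/
def leftTensor : 𝓢((Fin (nL i) → EuclideanSpace ℝ (Fin d)), ℂ) :=
  SchwartzMap.tensorFin (nL i) fun J => φcast φ i (Fin.castAdd (nR i) J)

/-- The **positions of the left points** at the other gaps `t'`. [folklore] -/
def leftPos (t' : Fin (m + n) → ℝ) (J : Fin (nL i)) : ℝ :=
  shTimes i w' (baseVec i w' t') (Fin.cast (nL_add_nR i) (Fin.castAdd (nR i) J))

/-- `leftPos` through the index `⟨J, _⟩ : Fin (m+n+2)`. [folklore] -/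
theorem leftPos_eq (t' : Fin (m + n) → ℝ) (J : Fin (nL i)) :
    leftPos i w' t' J = shTimes i w' (baseVec i w' t') ⟨J.val, by have := J.isLt; simp only [nL] at this; omega⟩ := by
  unfold leftPos
  congr 1

/-- **The left generator is the OS adjoint of the skeleton cluster `Ψ_L` at the left positions.** [folklore] -/
theorem leftGen_eq_osAdjoint (t' : Fin (m + n) → ℝ) :
    leftGen φ i w' t' = QuantumLattice.osAdjoint (skeletonFn (leftTensor φ i) (leftPos i w' t')) := rfl

/-- `timeVec (-s) = -timeVec s`. [folklore] -/
theorem timeVec_neg (s : ℝ) : timeVec (d := d) (-s) = -timeVec s := by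
  have h := timeVec_add (d := d) s (-s)
  rw [add_neg_cancel, timeVec_zero] at h
  -- `0 = timeVec s + timeVec (-s)`
  exact eq_neg_of_add_eq_zero_right h.symm

/-- **Forward time translates of the left generator**: `P(t')(· - s e₀) = Θ(Ψ_L-cluster at leftPos - s)*`. [folklore] -/
theorem translate_leftGen (t' : Fin (m + n) → ℝ) (s : ℝ) :
    QuantumLattice.translateMulti (timeVec s) (leftGen φ i w' t') =
      QuantumLattice.osAdjoint (skeletonFn (leftTensor φ i) fun J => leftPos i w' t' J - s) := by
  rw [leftGen_eq_osAdjoint]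
  have hθ : QuantumLattice.timeReflection d (timeVec (-s)) = timeVec s := by
    rw [timeReflection_timeVec, timeVec_neg, neg_neg]
  have h := osAdjoint_translateMulti (timeVec (d := d) (-s)) (skeletonFn (leftTensor φ i) (leftPos i w' t'))
  rw [hθ] at h
  rw [← h, translateMulti_skeletonFn]
  rfl

omit [NeZero d] in
/-- Norm of the left positions: `‖leftPos t'‖ ≤ 2(m+n+1)(|w'| + ‖t'‖) + |w'|`. [folklore] -/
theorem norm_leftPos_le (t' : Fin (m + n) → ℝ) :
    ‖leftPos i w' t'‖ ≤ 2 * ((m + n : ℕ) + 1) * (|w'| + ‖t'‖) + |w'| := by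
  refine (pi_norm_le_iff_of_nonneg (by positivity)).2 fun J => ?_
  rw [Real.norm_eq_abs]
  exact abs_shTimes_baseVec_le i w' t' _

/-- **Polynomial growth of the seminorms of the left generator** in the other gaps. [folklore] -/
theorem exists_seminorm_leftGen_le (k l : ℕ) :
    ∃ (C : ℝ) (N : ℕ), ∀ t' : Fin (m + n) → ℝ, SchwartzMap.seminorm ℂ k l (leftGen φ i w' t') ≤ C * (1 + ‖t'‖) ^ N := by
  set P : ℝ := SchwartzMap.seminorm ℂ k l (leftTensor φ i) + SchwartzMap.seminorm ℂ 0 l (leftTensor φ i) with hP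
  set A : ℝ := 2 * ((m + n : ℕ) + 1) with hA
  refine ⟨2 ^ k * (1 + A * |w'| + |w'| + A) ^ k * P, k, fun t' => ?_⟩
  rw [leftGen_eq_osAdjoint]
  refine (seminorm_osAdjoint_le _ k l).trans ((seminorm_skeletonFn_le _ k l _).trans ?_)
  have hP0 : 0 ≤ P := by positivity
  have hpos : 1 + ‖leftPos i w' t'‖ ≤ (1 + A * |w'| + |w'| + A) * (1 + ‖t'‖) := by
    have h := norm_leftPos_le i w' t'
    rw [← hA] at h
    have hA0 : 0 ≤ A := by positivity
    nlinarith [norm_nonneg t', abs_nonneg w', mul_nonneg hA0 (norm_nonneg t'), mul_nonneg hA0 (abs_nonneg w'),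
      mul_nonneg (mul_nonneg hA0 (abs_nonneg w')) (norm_nonneg t'), mul_nonneg (abs_nonneg w') (norm_nonneg t')]
  calc 2 ^ k * (1 + ‖leftPos i w' t'‖) ^ k * P ≤ 2 ^ k * ((1 + A * |w'| + |w'| + A) * (1 + ‖t'‖)) ^ k * P := by
        gcongr
    _ = 2 ^ k * (1 + A * |w'| + |w'| + A) ^ k * P * (1 + ‖t'‖) ^ k := by rw [mul_pow]; ring

end LeftFamily


/-! ### The regularised left cluster -/

section RegCluster

variable {d' m n : ℕ}

/-- The slot index `i₀ = m` (so that `nL i₀ = m + 1` definitionally). [folklore] -/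
abbrev slotIdx (m n : ℕ) : Fin (m + n + 1) := ⟨m, by omega⟩

variable (κL : Fin (m + 1) → 𝓢(ℝ, ℂ)) (hL : Fin (m + 1) → 𝓢(EuclideanSpace ℝ (Fin d'), ℂ))
  (w' b : ℝ) (θL : Fin m → 𝓢(ℝ, ℂ)) (ρC : 𝓢(ℝ, ℂ))

/-- The tensor of one-point tensors `⊗_J (κ_J ⊗ h_J)`. [folklore] -/
def optTensor : 𝓢((Fin (m + 1) → EuclideanSpace ℝ (Fin (d' + 1))), ℂ) :=
  SchwartzMap.tensorFin (m + 1) fun J => onePtTensor (κL J) (hL J)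

/-- **The gap profiles** `W'_a(g) = logW b θ_a (g - w')` as Schwartz functions of the point gap `g`. [folklore] -/
def gapProfiles (hb : 0 < b) (a : Fin m) : 𝓢(ℝ, ℂ) :=
  SchwartzMap.compSubConstCLM ℂ w' (logWSchwartz hb (θL a))

/-- Values of the gap profiles. [folklore] -/
theorem gapProfiles_apply (hb : 0 < b) (a : Fin m) (g : ℝ) :
    gapProfiles w' b θL hb a g = logW b (θL a) (g - w') := by
  rw [gapProfiles, SchwartzMap.compSubConstCLM_apply, logW_eq_logWSchwartz hb]

/-- **The anchor profile** `ρ'(t) = ρ(-w'/2 - t)`. [folklore] -/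
def anchorProfile : 𝓢(ℝ, ℂ) :=
  SchwartzMap.compSubConstCLM ℂ (-w' / 2) (SchwartzMap.compCLMOfContinuousLinearEquiv ℂ (ContinuousLinearEquiv.neg ℝ) ρC)

/-- Values of the anchor profile. [folklore] -/
theorem anchorProfile_apply (t : ℝ) : anchorProfile w' ρC t = ρC (-w' / 2 - t) := by
  simp only [anchorProfile, SchwartzMap.compSubConstCLM_apply, SchwartzMap.compCLMOfContinuousLinearEquiv_apply,
    Function.comp_apply, ContinuousLinearEquiv.coe_neg, Pi.neg_apply, id_eq]
  congr 1; ring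

/-- **The regularisation weight** on the point times. [folklore] -/
def clusterWeight (hb : 0 < b) : 𝓢((Fin (m + 1) → ℝ), ℂ) := regWeight (gapProfiles w' b θL hb) (anchorProfile w' ρC)

/-- **The regularised cluster** `𝒜 = ∫ hW(a) (⊗(κ_J ⊗ h_J))(· - a) da`. [cite: OsterwalderSchraderCMP1975, Ch. VI.1] -/
def regCluster (hb : 0 < b) : 𝓢((Fin (m + 1) → EuclideanSpace ℝ (Fin (d' + 1))), ℂ) :=
  avgCluster d' (m + 1) κL hL (toEucl (clusterWeight w' b θL ρC hb))

/-- **The regularised test function** `K = Θ 𝒜*`. [cite: OsterwalderSchraderCMP1975, Ch. VI.1] -/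
def regTest (hb : 0 < b) : 𝓢((Fin (m + 1) → EuclideanSpace ℝ (Fin (d' + 1))), ℂ) :=
  QuantumLattice.osAdjoint (regCluster κL hL w' b θL ρC hb)

/-- Integrals over the Euclidean model of `ℝᵐ⁺¹` are integrals over `Fin (m+1) → ℝ`. [folklore] -/
theorem integral_euclidean_eq {F : (Fin (m + 1) → ℝ) → ℂ} :
    ∫ a : EuclideanSpace ℝ (Fin (m + 1)), F (eTime (m + 1) a) = ∫ a : Fin (m + 1) → ℝ, F a :=
  (EuclideanSpace.volume_preserving_symm_measurableEquiv_toLp (Fin (m + 1))).integral_comp'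
    (f := (MeasurableEquiv.toLp 2 (Fin (m + 1) → ℝ)).symm) F

/-- **The regularised cluster as an integral over the point times.** [folklore] -/
theorem regCluster_apply (hb : 0 < b) (x : Fin (m + 1) → EuclideanSpace ℝ (Fin (d' + 1))) :
    regCluster κL hL w' b θL ρC hb x =
      ∫ a : Fin (m + 1) → ℝ, clusterWeight w' b θL ρC hb a *
        skeletonFn (optTensor κL hL) a x := by
  rw [regCluster, avgCluster_apply_eq_integral]
  simp_rw [toEucl_apply]
  exact integral_euclidean_eq (F := fun a => clusterWeight w' b θL ρC hb a * skeletonFn (optTensor κL hL) a x)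

/-! #### Support: the weight forces all point times `≤ -w'/2` -/

/-- Where the weight is nonzero the anchor time is `≤ -w'/2` and the points are time-ordered with gaps `> w'`. [folklore] -/
theorem le_of_clusterWeight_ne_zero (hb : 0 < b) (hw0 : 0 ≤ w') {L : ℝ} (hρsupp : ∀ s, s ∉ Icc 0 L → ρC s = 0)
    {a : Fin (m + 1) → ℝ} (ha : clusterWeight w' b θL ρC hb a ≠ 0) (J : Fin (m + 1)) : a J ≤ -w' / 2 := by
  rw [clusterWeight, regWeight_apply] at ha
  have hlast : a (Fin.last m) ≤ -w' / 2 := by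
    have h1 : anchorProfile w' ρC (a (Fin.last m)) ≠ 0 := left_ne_zero_of_mul ha
    rw [anchorProfile_apply] at h1
    by_contra hlt
    exact h1 (hρsupp _ fun hmem => hlt (by linarith [hmem.1]))
  have hgap : ∀ J' : Fin m, a J'.castSucc ≤ a J'.succ := by
    intro J'
    have h1 : gapProfiles w' b θL hb J' (a J'.succ - a J'.castSucc) ≠ 0 := by
      have hprod := right_ne_zero_of_mul ha
      exact (Finset.prod_ne_zero_iff.1 hprod) J' (Finset.mem_univ _)
    rw [gapProfiles_apply] at h1
    by_contra hlt
    exact h1 (logW_of_nonpos (by linarith [not_le.1 hlt]))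
  -- chain the gaps from `J` up to `last`
  suffices hchain : ∀ (q : ℕ) (J : Fin (m + 1)), m - J.val = q → a J ≤ a (Fin.last m) from
    (hchain _ J rfl).trans hlast
  intro q
  induction q with
  | zero =>
      intro J hJ
      have : J = Fin.last m := Fin.ext (by simp; omega)
      rw [this]
  | succ q ih =>
      intro J hJ
      have hJm : J.val < m := by omega
      set J' : Fin m := ⟨J.val, hJm⟩ with hJ'
      have hcs : J'.castSucc = J := Fin.ext rfl
      have hstep := hgap J'
      rw [hcs] at hstep
      exact hstep.trans (ih J'.succ (by simp [hJ']; omega))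

/-- **The regularised cluster vanishes unless all times are `≤ -(w'/2 - r)`.** [folklore] -/
theorem regCluster_eq_zero (hb : 0 < b) (hw0 : 0 ≤ w') {r L : ℝ} (hκ : ∀ J, tsupport (κL J : ℝ → ℂ) ⊆ Icc (-r) r)
    (hρsupp : ∀ s, s ∉ Icc 0 L → ρC s = 0)
    {x : Fin (m + 1) → EuclideanSpace ℝ (Fin (d' + 1))} {J : Fin (m + 1)} (hx : -(w' / 2 - r) < x J 0) :
    regCluster κL hL w' b θL ρC hb x = 0 := by
  rw [regCluster_apply]
  refine integral_eq_zero_of_ae (Eventually.of_forall fun a => ?_)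
  change clusterWeight w' b θL ρC hb a * skeletonFn (optTensor κL hL) a x = 0
  by_cases ha : clusterWeight w' b θL ρC hb a = 0
  · rw [ha, zero_mul]
  · have haJ := le_of_clusterWeight_ne_zero w' b θL ρC hb hw0 hρsupp ha J
    rw [optTensor, skeletonFn_tensorFin_onePtTensor_apply]
    have hzero : κL J (x J 0 - a J) = 0 := by
      refine image_eq_zero_of_notMem_tsupport fun hmem => ?_
      have := (hκ _ hmem).2
      linarith
    rw [Finset.prod_eq_zero (Finset.mem_univ J) hzero, zero_mul, mul_zero]

/-- **Support of the regularised cluster**: all times `≤ -(w'/2 - r)`. [folklore] -/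
theorem tsupport_regCluster (hb : 0 < b) (hw0 : 0 ≤ w') {r L : ℝ} (hκ : ∀ J, tsupport (κL J : ℝ → ℂ) ⊆ Icc (-r) r)
    (hρsupp : ∀ s, s ∉ Icc 0 L → ρC s = 0) :
    tsupport (regCluster κL hL w' b θL ρC hb : (Fin (m + 1) → EuclideanSpace ℝ (Fin (d' + 1))) → ℂ) ⊆
      {x | ∀ J, x J 0 ≤ -(w' / 2 - r)} := by
  have hclosed : IsClosed {x : Fin (m + 1) → EuclideanSpace ℝ (Fin (d' + 1)) | ∀ J, x J 0 ≤ -(w' / 2 - r)} := by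
    have : {x : Fin (m + 1) → EuclideanSpace ℝ (Fin (d' + 1)) | ∀ J, x J 0 ≤ -(w' / 2 - r)} =
        ⋂ J, {x | x J 0 ≤ -(w' / 2 - r)} := by ext x; simp
    rw [this]
    exact isClosed_iInter fun J => isClosed_le ((EuclideanSpace.proj (0 : Fin (d' + 1))).continuous.comp
      (continuous_apply J)) continuous_const
  refine closure_minimal (fun x hx => ?_) hclosed
  by_contra hnot
  simp only [mem_setOf_eq, not_forall, not_le] at hnot
  obtain ⟨J, hJ⟩ := hnot
  exact hx (regCluster_eq_zero κL hL w' b θL ρC hb hw0 hκ hρsupp hJ)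

/-- **The regularised test function is positive-time** (`2r < w'`). [folklore] -/
theorem isPositiveTimeMulti_regTest (hb : 0 < b) (hw0 : 0 ≤ w') {r L : ℝ} (hκ : ∀ J, tsupport (κL J : ℝ → ℂ) ⊆ Icc (-r) r)
    (hw : 2 * r < w') (hρsupp : ∀ s, s ∉ Icc 0 L → ρC s = 0) :
    IsPositiveTimeMulti (regTest κL hL w' b θL ρC hb) := by
  intro x hx J
  -- `K x ≠ 0` near `x` forces `𝒜 (θ x ∘ rev) ≠ 0` near, hence all reflected times `≤ -(w'/2 - r)`
  have hclosed : IsClosed {x : Fin (m + 1) → EuclideanSpace ℝ (Fin (d' + 1)) | ∀ J, w' / 2 - r ≤ x J 0} := by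
    have : {x : Fin (m + 1) → EuclideanSpace ℝ (Fin (d' + 1)) | ∀ J, w' / 2 - r ≤ x J 0} =
        ⋂ J, {x | w' / 2 - r ≤ x J 0} := by ext x; simp
    rw [this]
    exact isClosed_iInter fun J => isClosed_le continuous_const ((EuclideanSpace.proj (0 : Fin (d' + 1))).continuous.comp
      (continuous_apply J))
  have hsub : tsupport (regTest κL hL w' b θL ρC hb : (Fin (m + 1) → EuclideanSpace ℝ (Fin (d' + 1))) → ℂ) ⊆
      {x | ∀ J, w' / 2 - r ≤ x J 0} := by
    refine closure_minimal (fun y hy => ?_) hclosed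
    intro J'
    rw [Function.mem_support, regTest, QuantumLattice.osAdjoint_apply, map_ne_zero_iff _ (RingHom.injective _)] at hy
    have hmem := tsupport_regCluster κL hL w' b θL ρC hb hw0 hκ hρsupp (subset_tsupport _ hy) (Fin.rev J')
    simp only [Fin.rev_rev, QuantumLattice.timeReflection_apply, if_true] at hmem
    change -(y J' 0) ≤ -(w' / 2 - r) at hmem
    linarith
  have := hsub hx J
  linarith

end RegCluster

/-! ### The left instance -/

section LeftCluster

variable {d' m n : ℕ}

variable (κ : Fin (m + n + 2) → 𝓢(ℝ, ℂ)) (h : Fin (m + n + 2) → 𝓢(EuclideanSpace ℝ (Fin d'), ℂ))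
  (w' b : ℝ) (θ : Fin (m + n + 1) → 𝓢(ℝ, ℂ)) (ρC : 𝓢(ℝ, ℂ))

/-- **One-point-tensor profiles** `φ_j = κ_j ⊗ h_j`. [cite: OsterwalderSchraderCMP1975, Ch. V (5.3)] -/
def optProfiles : Fin (m + n + 2) → 𝓢(EuclideanSpace ℝ (Fin (d' + 1)), ℂ) := fun j => onePtTensor (κ j) (h j)

/-- The left time profiles `κ_J`, `J ≤ m`, indexed by `Fin (nL i₀) = Fin (m+1)`. [folklore] -/
def leftκ (J : Fin (m + 1)) : 𝓢(ℝ, ℂ) := κ (Fin.cast (nL_add_nR (slotIdx m n)) (Fin.castAdd (nR (slotIdx m n)) J))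

/-- The left spatial profiles `h_J`, `J ≤ m`. [folklore] -/
def lefth (J : Fin (m + 1)) : 𝓢(EuclideanSpace ℝ (Fin d'), ℂ) :=
  h (Fin.cast (nL_add_nR (slotIdx m n)) (Fin.castAdd (nR (slotIdx m n)) J))

/-- The left tensor of one-point-tensor profiles is the tensor of the left one-point tensors (syntactically). [folklore] -/
theorem leftTensor_optProfiles :
    leftTensor (optProfiles κ h) (slotIdx m n) = optTensor (leftκ κ) (lefth h) := rfl


/-- The left slot profiles `θ_{σ_{i₀}(a)}`, `a < m`. [folklore] -/
def leftθ (a : Fin m) : 𝓢(ℝ, ℂ) := θ ((slotIdx m n).succAbove (Fin.castAdd n a))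

/-- **The regularised left cluster** of the slot `i₀`. [cite: OsterwalderSchraderCMP1975, Ch. VI.1] -/
abbrev leftRegCluster (hb : 0 < b) : 𝓢((Fin (m + 1) → EuclideanSpace ℝ (Fin (d' + 1))), ℂ) :=
  regCluster (leftκ κ) (lefth h) w' b (leftθ θ) ρC hb

/-- **The regularised left test function** `K_L = Θ𝒜_L*`. [cite: OsterwalderSchraderCMP1975, Ch. VI.1] -/
abbrev leftRegTest (hb : 0 < b) : 𝓢((Fin (m + 1) → EuclideanSpace ℝ (Fin (d' + 1))), ℂ) :=
  regTest (leftκ κ) (lefth h) w' b (leftθ θ) ρC hb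

/-- Time supports of the left time profiles. [folklore] -/
theorem tsupport_leftκ {r : ℝ} (hκ : ∀ j, tsupport (κ j : ℝ → ℂ) ⊆ Icc (-r) r) (J : Fin (m + 1)) :
    tsupport (leftκ (n := n) κ J : ℝ → ℂ) ⊆ Icc (-r) r := hκ _

/-- **The regularised left test function is positive-time** (`2r < w'`). [folklore] -/
theorem isPositiveTimeMulti_leftRegTest (hb : 0 < b) (hw0 : 0 ≤ w') {r L : ℝ} (hκ : ∀ j, tsupport (κ j : ℝ → ℂ) ⊆ Icc (-r) r)
    (hw : 2 * r < w') (hρsupp : ∀ s, s ∉ Icc 0 L → ρC s = 0) :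
    IsPositiveTimeMulti (leftRegTest κ h w' b θ ρC hb) :=
  isPositiveTimeMulti_regTest (leftκ κ) (lefth h) w' b (leftθ θ) ρC hb hw0 (tsupport_leftκ κ hκ) hw hρsupp

/-- The left weight of `OSSlotFactorisation` through the left slot profiles. [folklore] -/
theorem leftWeight_eq_prod_leftθ (uL : Fin m → ℝ) :
    leftWeight (slotIdx m n) b (fun j => ⇑(θ j)) uL = ∏ a, logW b (leftθ θ a) (uL a) := rfl

end LeftCluster



section RegIdentity

variable {d' m : ℕ}

variable (κL : Fin (m + 1) → 𝓢(ℝ, ℂ)) (hL : Fin (m + 1) → 𝓢(EuclideanSpace ℝ (Fin d'), ℂ))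
  (w' b : ℝ) (θL : Fin m → 𝓢(ℝ, ℂ)) (ρC : 𝓢(ℝ, ℂ))

omit κL hL b θL ρC in
/-- Shifting the anchor shifts all point times. [folklore] -/
theorem gapAnchor_sub_anchor (t c : ℝ) (g : Fin m → ℝ) (J : Fin (m + 1)) :
    gapAnchor m (t - c, g) J = gapAnchor m (t, g) J - c := by
  rcases Fin.eq_castSucc_or_eq_last J with ⟨J', rfl⟩ | rfl
  · rw [gapAnchor_castSucc, gapAnchor_castSucc]; ring
  · rw [gapAnchor_last, gapAnchor_last]

/-- **Support of one-point tensors in time**: `tsupport (κ ⊗ h) ⊆ {y | |y⁰| ≤ r}` if `tsupport κ ⊆ [-r, r]`. [folklore] -/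
theorem tsupport_onePtTensor_subset {κ₁ : 𝓢(ℝ, ℂ)} (h₁ : 𝓢(EuclideanSpace ℝ (Fin d'), ℂ)) {r : ℝ}
    (hκ : tsupport (κ₁ : ℝ → ℂ) ⊆ Icc (-r) r) :
    tsupport (onePtTensor κ₁ h₁ : EuclideanSpace ℝ (Fin (d' + 1)) → ℂ) ⊆ {y | |y 0| ≤ r} := by
  have hclosed : IsClosed {y : EuclideanSpace ℝ (Fin (d' + 1)) | |y 0| ≤ r} :=
    isClosed_le (continuous_abs.comp (EuclideanSpace.proj (0 : Fin (d' + 1))).continuous) continuous_const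
  refine closure_minimal (fun y hy => ?_) hclosed
  rw [Function.mem_support, onePtTensor_apply] at hy
  have hκy : κ₁ (y 0) ≠ 0 := left_ne_zero_of_mul hy
  have hmem := hκ (subset_tsupport _ hκy)
  exact abs_le.2 ⟨by linarith [hmem.1], hmem.2⟩

/-- The substitution `(s, u) ↦ (t, g) = (-w'/2 - s, w'·1 + u)` as a measure-preserving equivalence of `ℝ × ℝᵐ`. [folklore] -/
def anchorGapSubst (w' : ℝ) (m : ℕ) : (ℝ × (Fin m → ℝ)) ≃ᵐ (ℝ × (Fin m → ℝ)) :=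
  MeasurableEquiv.prodCongr (MeasurableEquiv.subLeft (-w' / 2)) (MeasurableEquiv.addLeft (fun _ : Fin m => w'))

omit κL hL b θL ρC in
/-- Values of the substitution. [folklore] -/
@[simp] theorem anchorGapSubst_apply (z : ℝ × (Fin m → ℝ)) :
    anchorGapSubst w' m z = (-w' / 2 - z.1, fun a => w' + z.2 a) := by
  rcases z with ⟨s, u⟩
  simp [anchorGapSubst, MeasurableEquiv.prodCongr, MeasurableEquiv.subLeft, MeasurableEquiv.addLeft, Equiv.subLeft]
  rfl

omit κL hL b θL ρC in
/-- The substitution preserves Lebesgue measure. [folklore] -/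
theorem measurePreserving_anchorGapSubst :
    MeasurePreserving (anchorGapSubst w' m) ((volume : Measure ℝ).prod (volume : Measure (Fin m → ℝ)))
      ((volume : Measure ℝ).prod (volume : Measure (Fin m → ℝ))) :=
  (Measure.measurePreserving_sub_left (volume : Measure ℝ) (-w' / 2)).prod
    (measurePreserving_add_left (volume : Measure (Fin m → ℝ)) (fun _ : Fin m => w'))

/-- **The regularised cluster as the average over anchor shifts and gaps** (the substitution
`a = gapAnchor (-w'/2 - s, w' + u)`):
`𝒜(x) = ∫ ρ(s) (∏ logW θ_a(u_a)) (⊗ψ)(x - gapAnchor(-w'/2 - |s|, w' + u) e₀) d(s, u)`, the weights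
vanishing off `s ∈ [0, L]`, `u > 0`. [folklore] -/
theorem regCluster_eq_integral_gapAnchor (hb : 0 < b) {L : ℝ}
    (hρsupp : ∀ s, s ∉ Icc 0 L → ρC s = 0) (x : Fin (m + 1) → EuclideanSpace ℝ (Fin (d' + 1))) :
    regCluster κL hL w' b θL ρC hb x =
      ∫ z : ℝ × (Fin m → ℝ), (ρC z.1 * ∏ a, logW b (θL a) (z.2 a)) *
        skeletonFn (optTensor κL hL) (gapAnchor m (-w' / 2 - |z.1|, fun a => w' + z.2 a)) x
        ∂((volume : Measure ℝ).prod volume) := by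
  rw [regCluster_apply, ← integral_gapAnchor]
  rw [show ((volume : Measure (ℝ × (Fin m → ℝ)))) = (volume : Measure ℝ).prod volume from rfl]
  rw [← (measurePreserving_anchorGapSubst w').integral_comp' (f := anchorGapSubst w' m)]
  refine integral_congr_ae (Eventually.of_forall fun z => ?_)
  simp only [anchorGapSubst_apply]
  rw [clusterWeight, regWeight_gapAnchor]
  simp only [anchorProfile_apply, gapProfiles_apply, add_sub_cancel_left]
  have hρ : ρC (-w' / 2 - (-w' / 2 - z.1)) = ρC z.1 := by congr 1; ring
  rw [hρ]
  by_cases hz : ρC z.1 = 0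
  · rw [hz, zero_mul, zero_mul, zero_mul]
  · have hs : z.1 ∈ Icc 0 L := by by_contra hs; exact hz (hρsupp _ hs)
    rw [abs_of_nonneg hs.1]

/-- **The regularised test function as a superposition of OS adjoints of anchored clusters**:
`K(y) = ∫ ρ(s) conj(∏ logW θ_a(u_a)) · Θ((⊗ψ)(· - gapAnchor(-w'/2 - |s|, w' + u) e₀))*(y) d(s, u)` for a
real weight `ρ`. [folklore] -/
theorem regTest_apply_eq_integral_gapAnchor (hb : 0 < b) {L : ℝ}
    (hρsupp : ∀ s, s ∉ Icc 0 L → ρC s = 0) (hρim : ∀ s, (ρC s).im = 0)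
    (y : Fin (m + 1) → EuclideanSpace ℝ (Fin (d' + 1))) :
    regTest κL hL w' b θL ρC hb y =
      ∫ z : ℝ × (Fin m → ℝ), (((ρC z.1).re : ℂ) * conj (∏ a, logW b (θL a) (z.2 a))) *
        QuantumLattice.osAdjoint (skeletonFn (optTensor κL hL) (gapAnchor m (-w' / 2 - |z.1|, fun a => w' + z.2 a))) y
        ∂((volume : Measure ℝ).prod volume) := by
  have hconj : ∀ s, conj (ρC s) = (((ρC s).re : ℝ) : ℂ) := fun s => by
    apply Complex.ext <;> simp [hρim s]
  rw [regTest, QuantumLattice.osAdjoint_apply, regCluster_eq_integral_gapAnchor κL hL w' b θL ρC hb hρsupp, ← integral_conj]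
  refine integral_congr_ae (Eventually.of_forall fun z => ?_)
  change conj ((ρC z.1 * ∏ a, logW b (θL a) (z.2 a)) *
      skeletonFn (optTensor κL hL) (gapAnchor m (-w' / 2 - |z.1|, fun a => w' + z.2 a))
        (fun J => QuantumLattice.timeReflection (d' + 1) (y (Fin.rev J)))) =
    (((ρC z.1).re : ℂ) * conj (∏ a, logW b (θL a) (z.2 a))) *
      QuantumLattice.osAdjoint (skeletonFn (optTensor κL hL) (gapAnchor m (-w' / 2 - |z.1|, fun a => w' + z.2 a))) y
  rw [QuantumLattice.osAdjoint_apply, map_mul, map_mul, hconj]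

end RegIdentity

section LeftIdentity

variable {d' m n : ℕ}

variable (κ : Fin (m + n + 2) → 𝓢(ℝ, ℂ)) (h : Fin (m + n + 2) → 𝓢(EuclideanSpace ℝ (Fin d'), ℂ))
  (w' b : ℝ) (θ : Fin (m + n + 1) → 𝓢(ℝ, ℂ)) (ρC : 𝓢(ℝ, ℂ))

/-- The positions of the left points on the support of the weights are anchored configurations:
`leftPos i₀ w' (w' + (u_L ⧺ 0)) J - s = gapAnchor (-w'/2 - s, w' + u_L) J` for `u_L ≥ -w'`. [folklore] -/
theorem leftPos_sub_eq_gapAnchor (uL : Fin m → ℝ) (huL : ∀ a, 0 ≤ w' + uL a) (s : ℝ) (J : Fin (m + 1)) :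
    leftPos (slotIdx m n) w' (fun j => w' + Fin.append uL (0 : Fin n → ℝ) j) J - s =
      gapAnchor m (-w' / 2 - s, fun a => w' + uL a) J := by
  rw [gapAnchor_sub_anchor, leftPos_eq]
  congr 1
  exact shTimes_baseVec_left_eq_gapAnchor (slotIdx m n) w' rfl uL huL J

/-- **The pointwise identity `(hK)`**: the regularised left test function is the superposition of
the translated left generators with weight `ρ(s) conj(W_L(u_L))`. [folklore] -/
theorem leftRegTest_apply_eq_integral (hb : 0 < b) (hw0 : 0 ≤ w') {L : ℝ}
    (hρsupp : ∀ s, s ∉ Icc 0 L → ρC s = 0) (hρim : ∀ s, (ρC s).im = 0)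
    (y : Fin (m + 1) → EuclideanSpace ℝ (Fin (d' + 1))) :
    leftRegTest κ h w' b θ ρC hb y =
      ∫ z : ℝ × (Fin m → ℝ), (((ρC z.1).re : ℂ) * conj (leftWeight (slotIdx m n) b (fun j => ⇑(θ j)) z.2)) *
        translatedFamily (fun uL => leftGen (optProfiles κ h) (slotIdx m n) w' (fun j => w' + Fin.append uL (0 : Fin n → ℝ) j)) z y
        ∂((volume : Measure ℝ).prod volume) := by
  rw [leftRegTest, regTest_apply_eq_integral_gapAnchor (leftκ κ) (lefth h) w' b (leftθ θ) ρC hb hρsupp hρim]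
  refine integral_congr_ae (Eventually.of_forall fun z => ?_)
  change (((ρC z.1).re : ℂ) * conj (∏ a, logW b (leftθ θ a) (z.2 a))) *
      QuantumLattice.osAdjoint (skeletonFn (optTensor (leftκ κ) (lefth h)) (gapAnchor m (-w' / 2 - |z.1|, fun a => w' + z.2 a))) y =
    (((ρC z.1).re : ℂ) * conj (leftWeight (slotIdx m n) b (fun j => ⇑(θ j)) z.2)) *
      translatedFamily (fun uL => leftGen (optProfiles κ h) (slotIdx m n) w' (fun j => w' + Fin.append uL (0 : Fin n → ℝ) j)) z y
  rw [leftWeight_eq_prod_leftθ]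
  -- either the weight vanishes, or the positions are the anchored configuration
  by_cases hz : ∏ a, logW b (leftθ θ a) (z.2 a) = 0
  · rw [hz, map_zero, mul_zero, zero_mul, zero_mul]
  · have hu : ∀ a, 0 < z.2 a := fun a => by
      by_contra hle
      exact (Finset.prod_ne_zero_iff.1 hz a (Finset.mem_univ _)) (logW_of_nonpos (not_lt.1 hle))
    have hposfun : (fun J => leftPos (slotIdx m n) w' (fun j => w' + Fin.append z.2 (0 : Fin n → ℝ) j) J - |z.1|) =
        gapAnchor m (-w' / 2 - |z.1|, fun a => w' + z.2 a) :=
      funext fun J => leftPos_sub_eq_gapAnchor w' z.2 (fun a => by linarith [hu a]) |z.1| J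
    congr 1
    simp only [translatedFamily]
    rw [translate_leftGen, hposfun, leftTensor_optProfiles]

end LeftIdentity


section LeftBound

variable {d' m n : ℕ}

/-- Time support of the one-point-tensor profiles. [folklore] -/
theorem tsupport_optProfiles (κ : Fin (m + n + 2) → 𝓢(ℝ, ℂ)) (h : Fin (m + n + 2) → 𝓢(EuclideanSpace ℝ (Fin d'), ℂ))
    {r : ℝ} (hκ : ∀ j, tsupport (κ j : ℝ → ℂ) ⊆ Icc (-r) r) (j : Fin (m + n + 2)) :
    tsupport (optProfiles κ h j : EuclideanSpace ℝ (Fin (d' + 1)) → ℂ) ⊆ {y | |y 0| ≤ r} :=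
  tsupport_onePtTensor_subset (h j) (hκ j)

variable {𝔖 : SchwingerFamily (EuclideanSpace ℝ (Fin (d' + 1)))}

/-- **OS II, Ch. VI.1 — the damped superposed left vector is bounded by the OS vector of the
regularised left test function**: for one-point-tensor profiles `φ_j = κ_j ⊗ h_j` with
`supp κ_j ⊆ [-r, r]`, `2r < w'`, Schwartz slot profiles `θ`, and an averaging weight `ρ ≥ 0` on
`[0, L]` of mass one,
`‖e^{-LH} ∫ conj(W_L(u_L)) v(P(w' + (u_L, 0))) du_L‖ ≤ ‖v(Θ𝒜*)‖`, `𝒜 = leftRegCluster`.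
[cite: OsterwalderSchraderCMP1975, Ch. VI.1 pp. 297–298] -/
theorem norm_shiftH_leftSuperposed_le (hE1 : 𝔖.IsEuclideanCovariant) (hE2 : 𝔖.IsOSReflectionPositive)
    (κ : Fin (m + n + 2) → 𝓢(ℝ, ℂ)) (h : Fin (m + n + 2) → 𝓢(EuclideanSpace ℝ (Fin d'), ℂ))
    (i : Fin (m + n + 1)) (hi : i.val = m) {w' r : ℝ}
    (hκ : ∀ j, tsupport (κ j : ℝ → ℂ) ⊆ Icc (-r) r) (hw : 2 * r < w') (hw0 : 0 ≤ w') {b : ℝ} (hb : 0 < b)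
    (θ : Fin (m + n + 1) → 𝓢(ℝ, ℂ)) (ρC : 𝓢(ℝ, ℂ)) {L : ℝ} (hL : 0 < L) (hρ0 : ∀ s, 0 ≤ (ρC s).re)
    (hρim : ∀ s, (ρC s).im = 0) (hρ1 : ∫ s in (0 : ℝ)..L, (ρC s).re = 1) (hρsupp : ∀ s, s ∉ Icc 0 L → ρC s = 0) :
    ‖shiftH hE2 L (∫ uL : Fin m → ℝ, conj (leftWeight i b (fun j => ⇑(θ j)) uL) •
        leftVec 𝔖 hE2 (optProfiles κ h) i (tsupport_optProfiles κ h hκ) hw hw0 uL)‖ ≤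
      ‖ι 𝔖 hE2 (δ 𝔖 hE2 (mkGen (leftRegTest κ h w' b θ ρC hb)
        (isPositiveTimeMulti_leftRegTest κ h w' b θ ρC hb hw0 hκ hw hρsupp)))‖ := by
  obtain rfl : i = slotIdx m n := Fin.ext hi
  have hφ := tsupport_optProfiles κ h hκ
  -- the family, its weight, and their estimates
  have hpos : ∀ uL : Fin m → ℝ, IsPositiveTimeMulti
      (leftGen (optProfiles κ h) (slotIdx m n) w' (fun j => w' + Fin.append uL (0 : Fin n → ℝ) j)) :=
    fun uL => isPositiveTimeMulti_leftGen hφ hw hw0 _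
  have haffc : Continuous fun uL : Fin m → ℝ => fun j => w' + Fin.append uL (0 : Fin n → ℝ) j :=
    continuous_pi fun j => continuous_const.add ((continuous_apply j).comp ((continuous_finAppend (E := ℝ)).comp
      (continuous_id.prodMk continuous_const)))
  have hG : Continuous fun uL : Fin m → ℝ =>
      leftGen (optProfiles κ h) (slotIdx m n) w' (fun j => w' + Fin.append uL (0 : Fin n → ℝ) j) :=
    (continuous_leftGen (optProfiles κ h) _ w').comp haffc
  have haff : ∀ uL : Fin m → ℝ, 1 + ‖fun j => w' + Fin.append uL (0 : Fin n → ℝ) j‖ ≤ (1 + |w'|) * (1 + ‖uL‖) :=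
    fun uL => (one_add_norm_const_add_append_le w' uL 0).trans (by gcongr; simp)
  have hgrowth : ∀ k l : ℕ, ∃ (C : ℝ) (N : ℕ), ∀ uL : Fin m → ℝ, SchwartzMap.seminorm ℂ k l
      (leftGen (optProfiles κ h) (slotIdx m n) w' (fun j => w' + Fin.append uL (0 : Fin n → ℝ) j)) ≤ C * (1 + ‖uL‖) ^ N := by
    intro k l
    obtain ⟨C, N, hC⟩ := exists_seminorm_leftGen_le (optProfiles κ h) (slotIdx m n) w' k l
    refine ⟨|C| * (1 + |w'|) ^ N, N, fun uL => (hC _).trans ?_⟩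
    calc C * (1 + ‖fun j => w' + Fin.append uL (0 : Fin n → ℝ) j‖) ^ N
        ≤ |C| * (1 + ‖fun j => w' + Fin.append uL (0 : Fin n → ℝ) j‖) ^ N :=
          mul_le_mul_of_nonneg_right (le_abs_self C) (by positivity)
      _ ≤ |C| * ((1 + |w'|) * (1 + ‖uL‖)) ^ N := by gcongr; exact haff uL
      _ = |C| * (1 + |w'|) ^ N * (1 + ‖uL‖) ^ N := by rw [mul_pow]; ring
  obtain ⟨CL, NL, hCL0, hCL⟩ := exists_norm_δ_leftGen_le (optProfiles κ h) (slotIdx m n) w' 𝔖 hE2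
  have hv : ∃ (C : ℝ) (N : ℕ), ∀ uL : Fin m → ℝ,
      ‖ι 𝔖 hE2 (δ 𝔖 hE2 (mkGen (leftGen (optProfiles κ h) (slotIdx m n) w' (fun j => w' + Fin.append uL (0 : Fin n → ℝ) j))
        (hpos uL)))‖ ≤ C * (1 + ‖uL‖) ^ N := by
    refine ⟨CL * (1 + |w'|) ^ NL, NL, fun uL => ?_⟩
    rw [LinearIsometry.norm_map]
    refine (hCL _ _).trans ?_
    rw [mul_assoc, ← mul_pow]
    gcongr
    exact haff uL
  have hg : Continuous fun uL : Fin m → ℝ => conj (leftWeight (slotIdx m n) b (fun j => ⇑(θ j)) uL) := by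
    refine Complex.continuous_conj.comp ?_
    unfold leftWeight
    exact continuous_finsetProd _ fun a _ => (continuous_logW_schwartz hb (θ _)).comp (continuous_apply a)
  have hgi : ∀ N : ℕ, Integrable (fun uL : Fin m → ℝ => (1 + ‖uL‖) ^ N * ‖conj (leftWeight (slotIdx m n) b (fun j => ⇑(θ j)) uL)‖) := by
    intro N
    have hint := integrable_prod_logW_mul hb (fun a => θ ((slotIdx m n).succAbove (Fin.castAdd n a)))
      (G := fun uL : Fin m → ℝ => (((1 + ‖uL‖) ^ N : ℝ) : ℂ))
      (Complex.continuous_ofReal.comp ((continuous_const.add continuous_norm).pow N)).aestronglyMeasurable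
      (C := 1) (N := N) (fun u => by rw [Complex.norm_real, Real.norm_eq_abs, abs_of_nonneg (by positivity), one_mul])
    refine (hint.norm).congr (Eventually.of_forall fun uL => ?_)
    change ‖(∏ a, logW b (θ ((slotIdx m n).succAbove (Fin.castAdd n a))) (uL a)) * (((1 + ‖uL‖) ^ N : ℝ) : ℂ)‖ =
      (1 + ‖uL‖) ^ N * ‖conj (leftWeight (slotIdx m n) b (fun j => ⇑(θ j)) uL)‖
    rw [norm_mul, Complex.norm_real, Real.norm_eq_abs, abs_of_nonneg (by positivity), RCLike.norm_conj, mul_comm]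
    rfl
  have hρc : Continuous fun s => (ρC s).re := Complex.continuous_re.comp ρC.continuous
  have hρsupp' : ∀ s, s ∉ Icc 0 L → (ρC s).re = 0 := fun s hs => by rw [hρsupp s hs]; rfl
  have hK := leftRegTest_apply_eq_integral κ h w' b θ ρC hb hw0 hρsupp hρim
  exact norm_shiftH_integral_smul_le hE1 hE2 (μ := (volume : Measure (Fin m → ℝ))) _ hG hgrowth hpos hv _ hg hgi
    hρc hL hρ0 hρ1 hρsupp' _ _ hK

end LeftBound

end Literature.MathematicalPhysics.QuantumFieldTheory
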